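import Mathlib
import Summits.Ventures.PercRepro2.Defs
import Summits.Ventures.PercRepro2.Independence
import Summits.Ventures.PercRepro2.Harris
import Summits.Ventures.PercRepro2.Graph
import Summits.Ventures.PercRepro2.Exploration
import Summits.Ventures.PercRepro2.Events
import Summits.Ventures.PercRepro2.Induced
import Summits.Ventures.PercRepro2.R2PrimeThreeReduction
import Summits.Ventures.PercRepro2.YBridge
import Summits.Ventures.PercRepro2.HCov
import Summits.Ventures.PercRepro2.HubModel
import Summits.Ventures.PercRepro2.HubModel3
import Summits.Ventures.PercRepro2.HubLaw3
import Summits.Ventures.PercRepro2.HubPat3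
import Summits.Ventures.PercRepro2.HubHarris3
import Summits.Ventures.PercRepro2.HubBundle3
import Summits.Ventures.PercRepro2.HubEvents3
import Summits.Ventures.PercRepro2.HubBern3
import Summits.Ventures.PercRepro2.HubGc3
import Summits.Ventures.PercRepro2.HubKron3
import Summits.Ventures.PercRepro2.HubTab3
import Summits.Ventures.PercRepro2.HubTab3Data1
import Summits.Ventures.PercRepro2.HubTab3Data2
import Summits.Ventures.PercRepro2.HubTab3Data3
import Summits.Ventures.PercRepro2.HubTab3Data4
import Summits.Ventures.PercRepro2.HubTab3Data6
import Summits.Ventures.PercRepro2.HubTab3Data12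
import Summits.Ventures.PercRepro2.HubTab3Defs
import Summits.Ventures.PercRepro2.HubTab3Check1
import Summits.Ventures.PercRepro2.HubTab3Check2
import Summits.Ventures.PercRepro2.HubTab3Check3
import Summits.Ventures.PercRepro2.HubTab3Check4
import Summits.Ventures.PercRepro2.HubTab3Check5
import Summits.Ventures.PercRepro2.HubTab3Check6
import Summits.Ventures.PercRepro2.HubTab3Check7
import Summits.Ventures.PercRepro2.HubTab3Check8
import Summits.Ventures.PercRepro2.HubTab3Check9
import Summits.Ventures.PercRepro2.HubTab3Check10
import Summits.Ventures.PercRepro2.HubTab3Check11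
import Summits.Ventures.PercRepro2.HubTab3Check12
import Summits.Ventures.PercRepro2.HubTab3Check13
import Summits.Ventures.PercRepro2.HubTab3Check14
import Summits.Ventures.PercRepro2.HubTab3Check15
import Summits.Ventures.PercRepro2.HubTab3Check16
import Summits.Ventures.PercRepro2.HubTab3Check17
import Summits.Ventures.PercRepro2.HubTab3Check18

/-!
# The a₃-hub table identity and the coefficient cubics as certified sums
(blind cell PercRepro2, mine-2 g17)

From the kernel checks `kronK' (decode4 n) = certK n` (`HubTab3Check1–18.lean`, all `n < 256`):
* `Wtot3_atoms_eq` — **the table identity** `Wtot3 k (atoms t) = W_k(t)` for every type vector `k`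
  and atom triple `t`, where `W_k(t) = grp (dataK (idx4K k)) t` is the certified table (digit
  uniqueness `digits_unique_idxA` with the bounds `abs_Wtot3_le` and `absSum_lt`);
* `Ck3_eq_sum_atoms` — the coefficient cubic at the inner masses `m_π = P(Π = π)` is a sum over atom
  triples (the inconsistent patterns carry no mass);
* `Ck3_eq_certSum` — **the coefficient cubic is the certified sum** `Σ_{(t, w) ∈ dataK k} w · x_t`
  at the inner masses `x = innerMass3`; `HubTab3Cubics*.lean` identify these sums with the
  certificate cubics `HubCert3.Part_i.C_k` of `HubCert3Part1–6.lean`.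
-/

namespace Summit.Ventures.PercRepro2.Hub3

open Hub

section Index4

/-- The index of a type vector: `Σ_i k_i 4^i`. -/
def idx4K (k : Fin 4 → Fin 4) : ℕ := ∑ i, (k i : ℕ) * 4 ^ (i : ℕ)

/-- The index, written out. -/
lemma idx4K_eq (k : Fin 4 → Fin 4) : idx4K k = k 0 + 4 * k 1 + 16 * k 2 + 64 * k 3 := by
  simp only [idx4K, Fin.sum_univ_four]
  norm_num
  ring

/-- Decoding inverts the index. -/
lemma decode4_idx4K (k : Fin 4 → Fin 4) : decode4 (idx4K k) = k := by
  have h0 := (k 0).isLt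
  have h1 := (k 1).isLt
  have h2 := (k 2).isLt
  have h3 := (k 3).isLt
  have e := idx4K_eq k
  funext i
  apply Fin.ext
  fin_cases i
  · show idx4K k / 1 % 4 = (k 0 : ℕ)
    omega
  · show idx4K k / 4 % 4 = (k 1 : ℕ)
    omega
  · show idx4K k / 16 % 4 = (k 2 : ℕ)
    omega
  · show idx4K k / 64 % 4 = (k 3 : ℕ)
    omega

/-- The index of a type vector is below `4^4`. -/
lemma idx4K_lt (k : Fin 4 → Fin 4) : idx4K k < 256 := by
  have h0 := (k 0).isLt
  have h1 := (k 1).isLt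
  have h2 := (k 2).isLt
  have h3 := (k 3).isLt
  rw [idx4K_eq]
  omega

end Index4

section Checks

/-- **All 256 kernel checks.** -/
theorem check_all (n : ℕ) (hn : n < 256) : kronK' (decode4 n) = certK n := by
  interval_cases n
  exacts [check_0, check_1, check_2, check_3, check_4, check_5, check_6, check_7, check_8, check_9,
    check_10, check_11, check_12, check_13, check_14, check_15, check_16, check_17, check_18,
    check_19, check_20, check_21, check_22, check_23, check_24, check_25, check_26, check_27,
    check_28, check_29, check_30, check_31, check_32, check_33, check_34, check_35, check_36,
    check_37, check_38, check_39, check_40, check_41, check_42, check_43, check_44, check_45,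
    check_46, check_47, check_48, check_49, check_50, check_51, check_52, check_53, check_54,
    check_55, check_56, check_57, check_58, check_59, check_60, check_61, check_62, check_63,
    check_64, check_65, check_66, check_67, check_68, check_69, check_70, check_71, check_72,
    check_73, check_74, check_75, check_76, check_77, check_78, check_79, check_80, check_81,
    check_82, check_83, check_84, check_85, check_86, check_87, check_88, check_89, check_90,
    check_91, check_92, check_93, check_94, check_95, check_96, check_97, check_98, check_99,
    check_100, check_101, check_102, check_103, check_104, check_105, check_106, check_107,
    check_108, check_109, check_110, check_111, check_112, check_113, check_114, check_115,
    check_116, check_117, check_118, check_119, check_120, check_121, check_122, check_123,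
    check_124, check_125, check_126, check_127, check_128, check_129, check_130, check_131,
    check_132, check_133, check_134, check_135, check_136, check_137, check_138, check_139,
    check_140, check_141, check_142, check_143, check_144, check_145, check_146, check_147,
    check_148, check_149, check_150, check_151, check_152, check_153, check_154, check_155,
    check_156, check_157, check_158, check_159, check_160, check_161, check_162, check_163,
    check_164, check_165, check_166, check_167, check_168, check_169, check_170, check_171,
    check_172, check_173, check_174, check_175, check_176, check_177, check_178, check_179,
    check_180, check_181, check_182, check_183, check_184, check_185, check_186, check_187,
    check_188, check_189, check_190, check_191, check_192, check_193, check_194, check_195,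
    check_196, check_197, check_198, check_199, check_200, check_201, check_202, check_203,
    check_204, check_205, check_206, check_207, check_208, check_209, check_210, check_211,
    check_212, check_213, check_214, check_215, check_216, check_217, check_218, check_219,
    check_220, check_221, check_222, check_223, check_224, check_225, check_226, check_227,
    check_228, check_229, check_230, check_231, check_232, check_233, check_234, check_235,
    check_236, check_237, check_238, check_239, check_240, check_241, check_242, check_243,
    check_244, check_245, check_246, check_247, check_248, check_249, check_250, check_251,
    check_252, check_253, check_254, check_255]

end Checks

section Grouping

variable {R : Type*} [CommRing R]

/-- The certified table entry at an atom triple: the sum of the data weights with that key. -/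
def grp (L : List (ℕ × ℕ × ℕ × ℤ)) (t : Fin 15 × Fin 15 × Fin 15) : ℤ :=
  (L.map fun e => if keyOf e = t then e.2.2.2 else 0).sum

/-- `grp` on a cons. -/
lemma grp_cons (e : ℕ × ℕ × ℕ × ℤ) (L : List (ℕ × ℕ × ℕ × ℤ)) (t : Fin 15 × Fin 15 × Fin 15) :
    grp (e :: L) t = (if keyOf e = t then e.2.2.2 else 0) + grp L t := by
  simp [grp]

/-- **Regrouping a data sum by key**: `Σ_{(t, w) ∈ L} w · c_t = Σ_t grp L t · c_t`. -/
theorem sum_map_eq_sum_grp (L : List (ℕ × ℕ × ℕ × ℤ)) (c : Fin 15 × Fin 15 × Fin 15 → R) :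
    (L.map fun e => (e.2.2.2 : R) * c (keyOf e)).sum = ∑ t, (grp L t : R) * c t := by
  induction L with
  | nil => simp [grp]
  | cons e L ih =>
    simp only [List.map_cons, List.sum_cons, grp_cons, Int.cast_add, add_mul,
      Finset.sum_add_distrib, ih]
    congr 1
    have : ∀ t, ((if keyOf e = t then e.2.2.2 else (0 : ℤ) : ℤ) : R) * c t =
        if keyOf e = t then (e.2.2.2 : R) * c t else 0 := by
      intro t
      split_ifs <;> simp
    simp only [this, Finset.sum_ite_eq, Finset.mem_univ, if_true]

/-- `|grp L t| ≤ Σ |w|`. -/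
lemma abs_grp_le (L : List (ℕ × ℕ × ℕ × ℤ)) (t : Fin 15 × Fin 15 × Fin 15) :
    |grp L t| ≤ (L.map fun e => |e.2.2.2|).sum := by
  induction L with
  | nil => simp [grp]
  | cons e L ih =>
    rw [grp_cons, List.map_cons, List.sum_cons]
    refine (abs_add_le _ _).trans (add_le_add ?_ ih)
    split_ifs <;> simp

/-- The certified Kronecker number, regrouped by atom triple. -/
lemma certK_eq (n : ℕ) : certK n = ∑ t, grp (dataK n) t * KB ^ idxA t := by
  have h := sum_map_eq_sum_grp (R := ℤ) (dataK n) (fun t => KB ^ idxA t)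
  simpa [certK] using h

set_option maxHeartbeats 0 in
/-- The data weights are small: `Σ |w| < 2^31` for every type vector. -/
theorem absSum_lt : ∀ n < 256, ((dataK n).map fun e => |e.2.2.2|).sum < 2 ^ 31 := by
  decide +kernel

end Grouping

section Identity

/-- **THE TABLE IDENTITY**: the a₃-hub table of the Lean hub functions on the atoms is the certified
table `hub3_W.txt`, for every type vector and atom triple. -/
theorem Wtot3_atoms_eq (k : Fin 4 → Fin 4) (t : Fin 15 × Fin 15 × Fin 15) :
    Wtot3 k (atomPat3 t.1) (atomPat3 t.2.1) (atomPat3 t.2.2) = grp (dataK (idx4K k)) t := by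
  have h := check_all (idx4K k) (idx4K_lt k)
  rw [decode4_idx4K, kronK'_eq, kronK_eq, certK_eq] at h
  have key := digits_unique_idxA
    (fun t => Wtot3 k (atomPat3 t.1) (atomPat3 t.2.1) (atomPat3 t.2.2)) (grp (dataK (idx4K k)))
    (fun t => lt_of_le_of_lt (abs_Wtot3_le k _ _ _) (by norm_num))
    (fun t => lt_of_le_of_lt (abs_grp_le _ t) (absSum_lt _ (idx4K_lt k))) h
  exact congrFun key t

variable {V : Type*} {E : Type*} [Fintype E] [DecidableEq E] {R : Type*} [CommRing R]
  {ends : E → Sym2 V} {μ : Mark → V}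

/-- The inner-pattern law as a function on all patterns. -/
noncomputable def innerLaw (p : E → R) (ends : E → Sym2 V) (μ : Mark → V) : (Fin 6 → Bool) → R :=
  fun π => prob p {ω | innerPat3 ends μ ω = π}

/-- The inner law vanishes off the atoms. -/
lemma innerLaw_eq_zero (p : E → R) {π : Fin 6 → Bool} (hπ : ¬ Consistent π) :
    innerLaw p ends μ π = 0 :=
  prob_innerPat3_eq_zero_of_not_consistent p hπ

/-- The inner law on an atom is the inner mass. -/
lemma innerLaw_atom (p : E → R) (a : Fin 15) : innerLaw p ends μ (atomPat3 a) = innerMass3 p ends μ a :=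
  rfl

/-- **The coefficient cubic at the inner law is a sum over atom triples.** -/
theorem Ck3_eq_sum_atoms (p : E → R) (k : Fin 4 → Fin 4) :
    Ck3 (innerLaw p ends μ) k = ∑ t : Fin 15 × Fin 15 × Fin 15,
      (Wtot3 k (atomPat3 t.1) (atomPat3 t.2.1) (atomPat3 t.2.2) : R) *
        (innerMass3 p ends μ t.1 * innerMass3 p ends μ t.2.1 * innerMass3 p ends μ t.2.2) := by
  unfold Ck3 cub3
  simp only [Fintype.sum_prod_type]
  have hz : ∀ π, ¬ Consistent π → innerLaw p ends μ π = 0 := fun π h => innerLaw_eq_zero p h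
  have h1 : ∀ π₁, ¬ Consistent π₁ → (∑ π₂, ∑ π₃, (Wtot3 k π₁ π₂ π₃ : R) *
      (innerLaw p ends μ π₁ * innerLaw p ends μ π₂ * innerLaw p ends μ π₃)) = 0 :=
    fun π₁ h => by simp [hz π₁ h]
  rw [sum_atoms3 _ h1]
  refine Finset.sum_congr rfl fun a _ => ?_
  have h2 : ∀ π₂, ¬ Consistent π₂ → (∑ π₃, (Wtot3 k (atomPat3 a) π₂ π₃ : R) *
      (innerLaw p ends μ (atomPat3 a) * innerLaw p ends μ π₂ * innerLaw p ends μ π₃)) = 0 :=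
    fun π₂ h => by simp [hz π₂ h]
  rw [sum_atoms3 _ h2]
  refine Finset.sum_congr rfl fun b _ => ?_
  have h3 : ∀ π₃, ¬ Consistent π₃ → (Wtot3 k (atomPat3 a) (atomPat3 b) π₃ : R) *
      (innerLaw p ends μ (atomPat3 a) * innerLaw p ends μ (atomPat3 b) * innerLaw p ends μ π₃) = 0 :=
    fun π₃ h => by simp [hz π₃ h]
  rw [sum_atoms3 _ h3]
  rfl

/-- **The coefficient cubic is the certified sum** at the inner masses. -/
theorem Ck3_eq_certSum (p : E → R) (k : Fin 4 → Fin 4) :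
    Ck3 (innerLaw p ends μ) k = ((dataK (idx4K k)).map fun e => (e.2.2.2 : R) *
      (innerMass3 p ends μ (keyOf e).1 * innerMass3 p ends μ (keyOf e).2.1 *
        innerMass3 p ends μ (keyOf e).2.2)).sum := by
  rw [sum_map_eq_sum_grp (dataK (idx4K k))
    (fun t => innerMass3 p ends μ t.1 * innerMass3 p ends μ t.2.1 * innerMass3 p ends μ t.2.2),
    Ck3_eq_sum_atoms]
  refine Finset.sum_congr rfl fun t _ => ?_
  rw [Wtot3_atoms_eq]

end Identity

end Summit.Ventures.PercRepro2.Hub3
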